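/-
HONEST FRAMING: certified error envelopes and provably optimal rounding/accumulation schemes for
low-precision formats under stated cost models; every table by two implementations; no hardware or
vendor claims.
-/
import Summits.Ventures.CertifiedArithmetic.LowPrec.OptChainLabels

/-!
# The EFFECTIVE labelled chain law (OPTIMA.md §B, Theorem T9(e)) — part 1: the bound, ties-down maps

Theorem T9(a) (`exact_le_lchain`) charges every step `i` of a labelled chain
`S_i = fl_i (S_{i-1} + x_i)` its unit roundoff `u_{π_i}`.  A pure CONVERSION (`x_i = 0`) into a
format at least as wide as the format the running sum effectively lives in is EXACT and costs
nothing.  Statically: the running sum starts in `F(e₀)`; after an addition at precision `π` it is a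
generic float of `F(π)`; after a conversion to `π` it lives in `F(min(eff, π))`.  A conversion with
`π ≥ eff` is dropped; every other step keeps its `u_π`.  The resulting constant is the EFFECTIVE law
`1 + U_eff`, `U_eff = ueff e₀ steps ≤ Σ u_{π_i}`:

* `exact_le_lchain_eff` (T9(e), upper bound): `acc + Σ x_i ≤ (1 + U_eff) · S_n` for every chain,
  every nearest rounding, nonnegative grid data, start value `acc ∈ F(e₀)`.  Proof: delete the exact
  conversions (`prune`) — the computed values do not change — and apply T9(a) to what is left.
* `TiesDown`, `exists_roundNearest_tiesDown`: nearest maps resolving EVERY tie downwards exist;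
  `float_succ_le` (the float of `F(p)` next above a float `v ≥ 2^E` is `≥ v + 2^(E+1-p)`) and
  `fl_midpoint_down` (such a map sends the midpoint `v + u_p 2^E` back to `v`) are the two facts the
  attaining witness of part 2 (`OptChainLabelsEffWitness.lean`: `U_eff` is attained for EVERY
  add/convert pattern, so the effective law is the exact worst case over all nearest roundings) uses.

Certificate C21 (`certs/opt/chainlab_{A,B}.json`, field `L_eff`; `D_adv = L_eff` on 2363/2363 rows)
is the two-implementation check of both parts on precisions `{2,3,4,5}`.
-/

namespace Summit.Ventures.CertifiedArithmetic.LowPrec.Opt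

open Literature.ComputerArithmetic.JeannerodRump2018

/-! ## The effective unit-roundoff sum -/

/-- `ueff e ss`: the sum of `u_{π_i}` over the steps of `ss` that are NOT exact conversions, the
running sum entering `ss` living in `F(e)`.  A step with `x = 0` is a conversion; it is exact iff
its precision is `≥` the current effective precision; an addition resets the effective precision to
its own, a lossy conversion lowers it to its own. -/
def ueff : ℕ → List LStep → ℚ
  | _, [] => 0
  | e, s :: ss =>
      if s.x = 0 ∧ e ≤ s.prec then ueff e ss else unitRoundoff s.prec + ueff s.prec ss

/-- `prune e ss`: the chain with its exact conversions deleted. -/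
def prune : ℕ → List LStep → List LStep
  | _, [] => []
  | e, s :: ss => if s.x = 0 ∧ e ≤ s.prec then prune e ss else s :: prune s.prec ss

/-- `ueff` on the empty chain. -/
@[simp] theorem ueff_nil (e : ℕ) : ueff e [] = 0 := rfl

/-- `ueff` unfolds one step. -/
theorem ueff_cons (e : ℕ) (s : LStep) (ss : List LStep) :
    ueff e (s :: ss) =
      if s.x = 0 ∧ e ≤ s.prec then ueff e ss else unitRoundoff s.prec + ueff s.prec ss := rfl

/-- `prune` on the empty chain. -/
@[simp] theorem prune_nil (e : ℕ) : prune e [] = [] := rfl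

/-- `prune` unfolds one step. -/
theorem prune_cons (e : ℕ) (s : LStep) (ss : List LStep) :
    prune e (s :: ss) = if s.x = 0 ∧ e ≤ s.prec then prune e ss else s :: prune s.prec ss := rfl

/-- The unit roundoffs of the pruned chain add up to `ueff`. -/
theorem usum_prune : ∀ (e : ℕ) (ss : List LStep), usum (prune e ss) = ueff e ss
  | _, [] => rfl
  | e, s :: ss => by
      rw [prune_cons, ueff_cons]
      by_cases h : s.x = 0 ∧ e ≤ s.prec
      · rw [if_pos h, if_pos h, usum_prune e ss]
      · rw [if_neg h, if_neg h, usum_cons, usum_prune s.prec ss]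

/-- Pruning deletes only steps with `x = 0`: the exact sum is unchanged. -/
theorem xsum_prune : ∀ (e : ℕ) (ss : List LStep), xsum (prune e ss) = xsum ss
  | _, [] => rfl
  | e, s :: ss => by
      rw [prune_cons, xsum_cons]
      by_cases h : s.x = 0 ∧ e ≤ s.prec
      · rw [if_pos h, xsum_prune e ss, h.1, zero_add]
      · rw [if_neg h, xsum_cons, xsum_prune s.prec ss]

/-- The pruned chain is a sub-chain. -/
theorem mem_of_mem_prune : ∀ (e : ℕ) (ss : List LStep) {s : LStep}, s ∈ prune e ss → s ∈ ss
  | _, [], s, hs => by simp at hs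
  | e, t :: ss, s, hs => by
      rw [prune_cons] at hs
      by_cases h : t.x = 0 ∧ e ≤ t.prec
      · rw [if_pos h] at hs
        exact List.mem_cons_of_mem _ (mem_of_mem_prune e ss hs)
      · rw [if_neg h] at hs
        rcases List.mem_cons.mp hs with rfl | hs'
        · exact List.mem_cons_self
        · exact List.mem_cons_of_mem _ (mem_of_mem_prune t.prec ss hs')

/-- `ueff ≤ usum`: the effective law is at least as strong as T9(a). -/
theorem ueff_le_usum : ∀ (e : ℕ) (ss : List LStep), ueff e ss ≤ usum ss
  | _, [] => le_rfl
  | e, s :: ss => by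
      rw [ueff_cons, usum_cons]
      by_cases h : s.x = 0 ∧ e ≤ s.prec
      · rw [if_pos h]
        linarith [ueff_le_usum e ss, unitRoundoff_nonneg s.prec]
      · rw [if_neg h]
        linarith [ueff_le_usum s.prec ss]

/-- `0 ≤ ueff`. -/
theorem ueff_nonneg (e : ℕ) (ss : List LStep) : 0 ≤ ueff e ss := by
  rw [← usum_prune]; exact usum_nonneg _

/-- PRUNING DOES NOT CHANGE THE COMPUTATION: with the running sum in `F(e)`, an exact conversion
(`x = 0`, precision `≥ e`) is the identity (`fl_eq_self`), and after any other step the running sum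
is a float of that step's format. -/
theorem lchainEval_prune {emin : ℤ} :
    ∀ (e : ℕ) (ss : List LStep) (acc : ℚ), IsFloat e emin acc → (∀ s ∈ ss, s.OK emin) →
      lchainEval acc (prune e ss) = lchainEval acc ss
  | _, [], _, _, _ => rfl
  | e, s :: ss, acc, hacc, hss => by
      obtain ⟨-, hfl, -, -⟩ := hss s (by simp)
      have hrest : ∀ t ∈ ss, t.OK emin := fun t ht => hss t (by simp [ht])
      rw [prune_cons, lchainEval_cons]
      by_cases h : s.x = 0 ∧ e ≤ s.prec
      · rw [if_pos h, h.1, add_zero, fl_eq_self hfl (PTree.isFloat_mono h.2 hacc)]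
        exact lchainEval_prune e ss acc hacc hrest
      · rw [if_neg h, lchainEval_cons]
        exact lchainEval_prune s.prec ss _ (hfl _).1 hrest

/-- THE EFFECTIVE LABELLED CHAIN LAW (Theorem T9(e), upper bound): for a start value
`acc ∈ F(e₀)`, `acc ≥ 0`, and every admissible chain,
`acc + Σ x_i ≤ (1 + U_eff) · S_n` with `U_eff = ueff e₀ steps` — exact conversions are free. -/
theorem exact_le_lchain_eff {emin : ℤ} {e₀ : ℕ} (ss : List LStep) (acc : ℚ) (hacc0 : 0 ≤ acc)
    (hacc : IsFloat e₀ emin acc) (hss : ∀ s ∈ ss, s.OK emin) :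
    acc + xsum ss ≤ (1 + ueff e₀ ss) * lchainEval acc ss := by
  rw [← usum_prune, ← xsum_prune e₀ ss, ← lchainEval_prune e₀ ss acc hacc hss]
  exact exact_le_lchain (prune e₀ ss) acc hacc0 (isGrid_of_isFloat hacc)
    (fun s hs => hss s (mem_of_mem_prune e₀ ss hs))

/-- Relative form of T9(e): under-estimation `≤ U_eff / (1 + U_eff)` of the exact sum. -/
theorem lchain_eff_relative {emin : ℤ} {e₀ : ℕ} (ss : List LStep) (acc : ℚ) (hacc0 : 0 ≤ acc)
    (hacc : IsFloat e₀ emin acc) (hss : ∀ s ∈ ss, s.OK emin) :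
    (acc + xsum ss) - lchainEval acc ss ≤ ueff e₀ ss / (1 + ueff e₀ ss) * (acc + xsum ss) := by
  have hU := ueff_nonneg e₀ ss
  have h := exact_le_lchain_eff ss acc hacc0 hacc hss
  rw [div_mul_eq_mul_div, le_div_iff₀ (by linarith)]
  nlinarith [h, hU]

/-! ## Nearest maps resolving every tie downwards -/

/-- `fl` resolves EVERY tie downwards: a float at least as close to `t` as `fl t` is `≥ fl t`. -/
def TiesDown (p : ℕ) (emin : ℤ) (fl : ℚ → ℚ) : Prop :=
  ∀ t f : ℚ, IsFloat p emin f → |t - f| ≤ |t - fl t| → fl t ≤ f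

/-- ROUND-TO-NEAREST, TIES-DOWNWARD MAPS EXIST for every format: take any nearest map `f` and
replace `f t` by its mirror image `2t - f t` whenever that is a smaller float. -/
theorem exists_roundNearest_tiesDown (p : ℕ) (emin : ℤ) :
    ∃ fl : ℚ → ℚ, IsRoundNearest p emin fl ∧ TiesDown p emin fl := by
  classical
  choose f hF hmin using exists_nearest p emin
  refine ⟨fun t => if IsFloat p emin (2 * t - f t) ∧ 2 * t - f t ≤ f t then 2 * t - f t else f t,
    ?_, ?_⟩
  · intro t
    by_cases h : IsFloat p emin (2 * t - f t) ∧ 2 * t - f t ≤ f t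
    · simp only [if_pos h]
      refine ⟨h.1, fun g hg => ?_⟩
      rw [show t - (2 * t - f t) = -(t - f t) by ring, abs_neg]
      exact hmin t g hg
    · simp only [if_neg h]
      exact ⟨hF t, hmin t⟩
  · intro t g hg hle
    by_cases h : IsFloat p emin (2 * t - f t) ∧ 2 * t - f t ≤ f t
    · simp only [if_pos h] at hle ⊢
      rw [show t - (2 * t - f t) = -(t - f t) by ring, abs_neg] at hle
      rcases abs_eq_abs.mp (le_antisymm hle (hmin t g hg)) with h1 | h1
      · linarith [h.2]
      · linarith
    · simp only [if_neg h] at hle ⊢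
      by_contra hlt
      push Not at hlt
      rcases abs_eq_abs.mp (le_antisymm hle (hmin t g hg)) with h1 | h1
      · linarith
      · exact h ⟨by rw [show 2 * t - f t = g by linarith]; exact hg, by linarith⟩

/-- `2^E · u_p = 2^(E-p)`. -/
theorem two_zpow_mul_unitRoundoff (E : ℤ) (p : ℕ) :
    (2 : ℚ) ^ E * unitRoundoff p = (2 : ℚ) ^ (E - p) := by
  unfold unitRoundoff
  rw [zpow_sub₀ (by norm_num : (2 : ℚ) ≠ 0), zpow_natCast]
  ring

/-- The exponent of a float `M · 2^k ≥ 2^E` of `F(p)` is `≥ E + 1 - p`. -/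
theorem exp_ge_of_two_zpow_le {p : ℕ} {E k M : ℤ} (hM : |M| < 2 ^ p)
    (hle : (2 : ℚ) ^ E ≤ (M : ℚ) * (2 : ℚ) ^ k) : E + 1 - p ≤ k := by
  by_contra hlt
  push Not at hlt
  have hMq : ((M : ℤ) : ℚ) < (2 : ℚ) ^ (p : ℕ) := by
    have : (M : ℚ) ≤ |(M : ℚ)| := le_abs_self _
    have h' : (|(M : ℚ)|) < 2 ^ p := by exact_mod_cast hM
    linarith
  have hk0 : (0 : ℚ) < (2 : ℚ) ^ k := zpow_pos (by norm_num) _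
  have : (M : ℚ) * (2 : ℚ) ^ k < (2 : ℚ) ^ E :=
    calc (M : ℚ) * (2 : ℚ) ^ k < (2 : ℚ) ^ (p : ℕ) * (2 : ℚ) ^ k := by gcongr
      _ = (2 : ℚ) ^ ((p : ℤ) + k) := by rw [zpow_add₀ (by norm_num), zpow_natCast]
      _ ≤ (2 : ℚ) ^ E := zpow_le_zpow_right₀ (by norm_num) (by omega)
  linarith

/-- FLOAT SPACING ABOVE `2^E`: if `v ≥ 2^E` and `f > v` are floats of `F(p)`, then
`f ≥ v + 2^(E+1-p)` (both are multiples of `2^(E+1-p)`). -/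
theorem float_succ_le {p : ℕ} {emin E : ℤ} {v f : ℚ} (hv : IsFloat p emin v)
    (hEv : (2 : ℚ) ^ E ≤ v) (hf : IsFloat p emin f) (hvf : v < f) :
    v + (2 : ℚ) ^ (E + 1 - p) ≤ f := by
  obtain ⟨M, k, hM, -, rfl⟩ := hv
  obtain ⟨M', k', hM', -, rfl⟩ := hf
  have hk := exp_ge_of_two_zpow_le hM hEv
  have hk' := exp_ge_of_two_zpow_le hM' (hEv.trans hvf.le)
  obtain ⟨a, ha⟩ := Int.eq_ofNat_of_zero_le (show 0 ≤ k - (E + 1 - p) by omega)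
  obtain ⟨b, hb⟩ := Int.eq_ofNat_of_zero_le (show 0 ≤ k' - (E + 1 - p) by omega)
  set δ : ℚ := (2 : ℚ) ^ (E + 1 - p) with hδ
  have hδ0 : 0 < δ := zpow_pos (by norm_num) _
  have e1 : (2 : ℚ) ^ k = (2 : ℚ) ^ (a : ℕ) * δ := by
    rw [hδ, ← zpow_natCast, ← zpow_add₀ (by norm_num : (2 : ℚ) ≠ 0)]; congr 1; omega
  have e2 : (2 : ℚ) ^ k' = (2 : ℚ) ^ (b : ℕ) * δ := by
    rw [hδ, ← zpow_natCast, ← zpow_add₀ (by norm_num : (2 : ℚ) ≠ 0)]; congr 1; omega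
  rw [e1, e2] at hvf ⊢
  have hAB : ((M * 2 ^ a : ℤ) : ℚ) < ((M' * 2 ^ b : ℤ) : ℚ) := by
    have h1 : ((M * 2 ^ a : ℤ) : ℚ) * δ < ((M' * 2 ^ b : ℤ) : ℚ) * δ := by
      push_cast; nlinarith [hvf, hδ0]
    exact lt_of_mul_lt_mul_right h1 hδ0.le
  have hAB1 : (M * 2 ^ a : ℤ) + 1 ≤ M' * 2 ^ b := by exact_mod_cast hAB
  have hq : ((M * 2 ^ a : ℤ) : ℚ) + 1 ≤ ((M' * 2 ^ b : ℤ) : ℚ) := by exact_mod_cast hAB1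
  calc (M : ℚ) * ((2 : ℚ) ^ (a : ℕ) * δ) + δ = (((M * 2 ^ a : ℤ) : ℚ) + 1) * δ := by
        push_cast; ring
    _ ≤ ((M' * 2 ^ b : ℤ) : ℚ) * δ := by gcongr
    _ = (M' : ℚ) * ((2 : ℚ) ^ (b : ℕ) * δ) := by push_cast; ring

/-- THE MIDPOINT GOES DOWN: a ties-downward nearest map into `F(p)` sends `v + u_p 2^E`, `v ≥ 2^E`
a float of `F(p)`, to `v` (the only floats within `u_p 2^E` of it are `v` and, in case of a tie,
`v + 2 u_p 2^E`). -/
theorem fl_midpoint_down {p : ℕ} {emin E : ℤ} {fl : ℚ → ℚ} (hfl : IsRoundNearest p emin fl)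
    (htd : TiesDown p emin fl) {v : ℚ} (hv : IsFloat p emin v) (hEv : (2 : ℚ) ^ E ≤ v) :
    fl (v + (2 : ℚ) ^ E * unitRoundoff p) = v := by
  rw [two_zpow_mul_unitRoundoff]
  set t := v + (2 : ℚ) ^ (E - p) with ht
  have hpos : (0 : ℚ) < (2 : ℚ) ^ (E - p) := zpow_pos (by norm_num) _
  have hδ : (2 : ℚ) ^ (E + 1 - p) = 2 * (2 : ℚ) ^ (E - p) := by
    rw [show E + 1 - (p : ℤ) = (E - p) + 1 by omega, zpow_add_one₀ (by norm_num : (2 : ℚ) ≠ 0)]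
    ring
  obtain ⟨hF, hmin⟩ := hfl t
  have htv : |t - v| = (2 : ℚ) ^ (E - p) := by
    rw [show t - v = (2 : ℚ) ^ (E - p) by rw [ht]; ring]; exact abs_of_pos hpos
  have h1 : |t - fl t| ≤ (2 : ℚ) ^ (E - p) := htv ▸ hmin v hv
  obtain ⟨h1l, h1r⟩ := abs_le.mp h1
  have hlo : v ≤ fl t := by rw [ht] at h1r; linarith
  rcases eq_or_lt_of_le hlo with heq | hgt
  · exact heq.symm
  · exfalso
    have hge := float_succ_le hv hEv hF hgt
    rw [hδ] at hge
    have htie : |t - v| ≤ |t - fl t| := by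
      rw [htv, show t - fl t = -((2 : ℚ) ^ (E - p)) by rw [ht] at h1l ⊢; linarith, abs_neg,
        abs_of_pos hpos]
    have := htd t v hv htie
    linarith

end Summit.Ventures.CertifiedArithmetic.LowPrec.Opt
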